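import Summits.AtomisticToContinuum.Crystallization.Theorems.PhononSlackCertificatesPeriodicGivenLayeredRegistry3
import Summits.AtomisticToContinuum.Crystallization.Theorems.PricedLinkCensusStackingHingeLjDominationDual
import Summits.AtomisticToContinuum.Crystallization.Theorems.HullExactificationCascadeHcpLandscapeGapStubSlipLayerBernstein
import Literature.MathematicalPhysics.StatisticalMechanics.BarlowStackingEnergy
import Literature.Algebra.EuclideanLattices.FccBccLattices

/-!
# Crux `HcpLandscapeGap` (stmt-AtomisticToContinuum-12087), line `registered` (birth) — stub POIS
# `stub_slipThetaPoisson`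

STUB POIS of the far-layer lateral bound of the slip cut (`Cruxes/HcpLandscapeGap/Lines/birth.lean`,
lead c7): the DUAL-SPACE facts about the shifted Gaussian layer sums of the triangular layer.  With
`L = ℤ (1,0) + ℤ (1/2, √3/2) ⊂ ℝ²` the unit triangular lattice of
`PhononSlackCertificatesPeriodicGivenLayeredRegistry3.lean` (the `ℤ`-span of the basis
`basisOfLinearIndependentOfCardEqFinrank LayeredHull.reg_linearIndependent_plane _`) and `L*` its dual
lattice (`Literature.Algebra.EuclideanLattices.dualLattice`):

* (1) `L* = ℤ ξ₁ ⊕ ℤ ξ₂`, `ξ₁ = (1, −√3/3)`, `ξ₂ = (0, 2√3/3)` (the dual basis of `u = (1,0)`,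
  `v = (1/2, √3/2)`), as an equivalence `ℤ × ℤ ≃ L*`, `(m, n) ↦ m ξ₁ + n ξ₂`: the combinations lie
  in `L*` (`LayeredHull.reg_mem_dual`), the map is injective (first coordinate `m`, second
  `(2n − m) √3/3`, `PricedHcpWindowsLjDomination.ljd_psi_apply`), and it is onto
  (`PricedHcpWindowsLjDomination.ljd_dual_exists`: for `x ∈ L*` the integers `m = ⟪x, u⟫`,
  `n = ⟪x, v⟫` satisfy `x = m ξ₁ + n ξ₂`);
* (2) `‖m ξ₁ + n ξ₂‖² = (4/3) (m² − m n + n²)` (`PricedHcpWindowsLjDomination.ljd_norm_psi_sq`);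
* (3) for `a, c > 0` and an in-plane `ξ ∈ ℝ³` (third coordinate `ξ 2 = 0`), the Poisson identity
  `Σ'_{(i,j)} e^{−c ‖i u_a + j v_a + ξ‖²}`
  `= (2/√3) (π/(a²c)) Σ'_{w ∈ L*} e^{−(π²/(a²c)) ‖w‖²} cos (2π ⟪a⁻¹ ξ', w⟫)`,
  `ξ' = (ξ 0, ξ 1)`, `u_a = triangularVec₁ a`, `v_a = triangularVec₂ a`, together with the
  summability of the dual series.  This is `LayeredHull.reg_tsum_plane_poisson` (spacing `1`,
  parameter `t = a² c`, shift `x = −a⁻¹ ξ'`) after the scaling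
  `‖i u_a + j v_a + ξ‖ = a ‖i u + j v + a⁻¹ ξ'‖` (coordinates, `norm_sq_fin_three`) and
  `cos (2π ⟪−y, w⟫) = cos (2π ⟪y, w⟫)`; summability is `LayeredHull.reg_summable_dual`.

All [folklore] (Conway–Sloane, *Sphere packings, lattices and groups*, Ch. 4 §6.2: the hexagonal
lattice, its dual and theta series).  No new definitions: the equivalence of (1) is built
anonymously with `Equiv.ofBijective`.
-/

noncomputable section

namespace Summit.AtomisticToContinuum.Crystallization.Theorems.HcpLandscapeGapBirth

open Real
open scoped BigOperators
open Literature.MathematicalPhysics.StatisticalMechanics Literature.Algebra.EuclideanLattices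
open Summit.AtomisticToContinuum.Crystallization.Theorems

namespace SlipThetaPoisson

/-! ### The dual basis `ξ₁ = (1, −√3/3)`, `ξ₂ = (0, 2√3/3)` -/

/-- The map `(m, n) ↦ m ξ₁ + n ξ₂` is injective (compare the coordinates `m` and `(2n − m) √3/3`,
`PricedHcpWindowsLjDomination.ljd_psi_apply`). [folklore] -/
theorem dualVec_injective :
    Function.Injective fun mn : ℤ × ℤ =>
      (mn.1 : ℝ) • (!₂[1, -(Real.sqrt 3 / 3)] : EuclideanSpace ℝ (Fin 2)) +
        (mn.2 : ℝ) • (!₂[0, 2 * Real.sqrt 3 / 3] : EuclideanSpace ℝ (Fin 2)) := by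
  have hs3 : 0 < Real.sqrt 3 := by positivity
  rintro ⟨m, n⟩ ⟨m', n'⟩ h
  have h0 := congrArg (fun w : EuclideanSpace ℝ (Fin 2) => w 0) h
  have h1 := congrArg (fun w : EuclideanSpace ℝ (Fin 2) => w 1) h
  simp only [(PricedHcpWindowsLjDomination.ljd_psi_apply _ _).1,
    (PricedHcpWindowsLjDomination.ljd_psi_apply _ _).2] at h0 h1
  have hm : m = m' := by exact_mod_cast h0
  subst hm
  have hn : (n : ℝ) = n' := by nlinarith [hs3]
  have hn' : n = n' := by exact_mod_cast hn
  rw [hn']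

/-! ### The scaling of the shifted layer norms -/

/-- **Scaling**: for in-plane `ξ`, `−c ‖i u_a + j v_a + ξ‖² = −(a² c) ‖i u + j v − (−a⁻¹ ξ')‖²`,
`ξ' = (ξ 0, ξ 1)` (`a ≠ 0`; coordinates). [folklore] -/
theorem neg_mul_norm_sq_slip {a : ℝ} (ha : a ≠ 0) (c : ℝ) (i j : ℤ) (ξ : EuclideanSpace ℝ (Fin 3))
    (hξ : ξ 2 = 0) :
    -c * ‖(i : ℝ) • triangularVec₁ a + (j : ℝ) • triangularVec₂ a + ξ‖ ^ 2 =
      -(a ^ 2 * c) * ‖(i : ℝ) • (!₂[1, 0] : EuclideanSpace ℝ (Fin 2)) +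
        (j : ℝ) • !₂[1 / 2, Real.sqrt 3 / 2] -
          (-(a⁻¹ • (!₂[ξ 0, ξ 1] : EuclideanSpace ℝ (Fin 2))))‖ ^ 2 := by
  obtain ⟨e0, e1, e2⟩ := SlipLayerBernstein.slipVec_apply a i j ξ
  rw [norm_sq_fin_three, e0, e1, e2, hξ, sub_neg_eq_add, ← real_inner_self_eq_norm_sq,
    LayeredHull.reg_inner_fin_two]
  simp only [Fin.isValue, ne_eq, OfNat.ofNat_ne_zero, not_false_eq_true, zero_pow, add_zero, neg_mul, one_div,
    PiLp.add_apply, PiLp.smul_apply, Matrix.cons_val_zero, smul_eq_mul, mul_one, Matrix.cons_val_one,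
    Matrix.cons_val_fin_one, mul_zero, zero_add, neg_inj]
  field_simp

end SlipThetaPoisson

/-- **Stub POIS (`stub_slipThetaPoisson`).**  With `L = ℤ (1,0) + ℤ (1/2, √3/2)` the unit triangular
plane lattice and `L*` its dual lattice: (1) `L* = {m ξ₁ + n ξ₂}`, `ξ₁ = (1, −√3/3)`, `ξ₂ = (0, 2√3/3)`,
as an equivalence `ℤ × ℤ ≃ L*`; (2) `‖m ξ₁ + n ξ₂‖² = (4/3)(m² − m n + n²)`; (3) for `a, c > 0` and
in-plane `ξ ∈ ℝ³`, the dual series is summable and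
`Σ'_{(i,j)} e^{−c ‖i u_a + j v_a + ξ‖²} = (2/√3)(π/(a²c)) Σ'_{w ∈ L*} e^{−(π²/(a²c)) ‖w‖²} cos (2π ⟪a⁻¹ (ξ 0, ξ 1), w⟫)`
(Poisson summation, `LayeredHull.reg_tsum_plane_poisson`, by scaling). [folklore] -/
theorem stub_slipThetaPoisson : (∃ e : ℤ × ℤ ≃ ↥(Literature.Algebra.EuclideanLattices.dualLattice (Submodule.span ℤ (Set.range ⇑(basisOfLinearIndependentOfCardEqFinrank Summit.AtomisticToContinuum.Crystallization.Theorems.LayeredHull.reg_linearIndependent_plane Summit.AtomisticToContinuum.Crystallization.Theorems.LayeredHull.reg_card_eq_finrank_plane)))), ∀ mn : ℤ × ℤ, ((e mn : ↥(Literature.Algebra.EuclideanLattices.dualLattice (Submodule.span ℤ (Set.range ⇑(basisOfLinearIndependentOfCardEqFinrank Summit.AtomisticToContinuum.Crystallization.Theorems.LayeredHull.reg_linearIndependent_plane Summit.AtomisticToContinuum.Crystallization.Theorems.LayeredHull.reg_card_eq_finrank_plane))))) : EuclideanSpace ℝ (Fin 2)) = (mn.1 : ℝ) • (!₂[1, -(Real.sqrt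 3 / 3)] : EuclideanSpace ℝ (Fin 2)) + (mn.2 : ℝ) • (!₂[0, 2 * Real.sqrt 3 / 3] : EuclideanSpace ℝ (Fin 2))) ∧ (∀ m n : ℤ, ‖(m : ℝ) • (!₂[1, -(Real.sqrt 3 / 3)] : EuclideanSpace ℝ (Fin 2)) + (n : ℝ) • (!₂[0, 2 * Real.sqrt 3 / 3] : EuclideanSpace ℝ (Fin 2))‖ ^ 2 = 4 / 3 * ((m : ℝ) ^ 2 - m * n + n ^ 2)) ∧ (∀ (a c : ℝ), 0 < a → 0 < c → ∀ ξ : EuclideanSpace ℝ (Fin 3), ξ 2 = 0 → Summable (fun w : ↥(Literature.Algebra.EuclideanLattices.dualLattice (Submodule.span ℤ (Set.range ⇑(basisOfLinearIndependentOfCardEqFinrank Summit.AtomisticToContinuum.Crystallization.Theorems.LayeredHull.reg_linearIndependent_plane Summit.AtomisticToContinuum.Crystallization.Theorems.LayeredHull.reg_card_eq_finrank_plane)))) => Real.exp (-((Real.pi ^ 2 / (a ^ 2 * c)) * ‖(w : EuclideanSpace ℝ (Fin 2))‖ ^ 2)) * Real.cos (2 * Real.pi * inner ℝ (a⁻¹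 • (!₂[(ξ) 0, (ξ) 1] : EuclideanSpace ℝ (Fin 2))) (w : EuclideanSpace ℝ (Fin 2)))) ∧ (∑' ij : ℤ × ℤ, Real.exp (-(c) * ‖(ij.1 : ℝ) • Literature.MathematicalPhysics.StatisticalMechanics.triangularVec₁ a + (ij.2 : ℝ) • Literature.MathematicalPhysics.StatisticalMechanics.triangularVec₂ a + (ξ)‖ ^ 2)) = 2 / Real.sqrt 3 * (Real.pi / (a ^ 2 * c)) * (∑' w : ↥(Literature.Algebra.EuclideanLattices.dualLattice (Submodule.span ℤ (Set.range ⇑(basisOfLinearIndependentOfCardEqFinrank Summit.AtomisticToContinuum.Crystallization.Theorems.LayeredHull.reg_linearIndependent_plane Summit.AtomisticToContinuum.Crystallization.Theorems.LayeredHull.reg_card_eq_finrank_plane)))), Real.exp (-((Real.pi ^ 2 / (a ^ 2 * c)) * ‖(w : EuclideanSpace ℝ (Fin 2))‖ ^ 2)) * Real.cos (2 * Real.pi * inner ℝ ((a)⁻¹ • (!₂[(ξ) 0, (ξ) 1] : EuclideanSpace ℝ (Fin 2))) (w : EuclideanSpace ℝ (Fin 2))))) := by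
  refine ⟨⟨Equiv.ofBijective (fun mn : ℤ × ℤ => ⟨(mn.1 : ℝ) • (!₂[1, -(Real.sqrt 3 / 3)] : EuclideanSpace ℝ (Fin 2)) +
      (mn.2 : ℝ) • (!₂[0, 2 * Real.sqrt 3 / 3] : EuclideanSpace ℝ (Fin 2)), LayeredHull.reg_mem_dual mn.1 mn.2⟩)
      ⟨fun mn mn' h => SlipThetaPoisson.dualVec_injective (congrArg Subtype.val h), fun w => ?_⟩,
    fun mn => rfl⟩, PricedHcpWindowsLjDomination.ljd_norm_psi_sq, fun a c ha hc ξ hξ => ?_⟩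
  · -- surjectivity
    obtain ⟨mn, hmn⟩ :=
      PricedHcpWindowsLjDomination.ljd_dual_exists (w : EuclideanSpace ℝ (Fin 2)) w.2
    exact ⟨mn, Subtype.ext hmn⟩
  · have ht : 0 < a ^ 2 * c := by positivity
    set y : EuclideanSpace ℝ (Fin 2) := a⁻¹ • (!₂[ξ 0, ξ 1] : EuclideanSpace ℝ (Fin 2)) with hy
    refine ⟨?_, ?_⟩
    · refine (LayeredHull.reg_summable_dual ht y).congr fun w => ?_
      rw [show -(π ^ 2 * ‖(w : EuclideanSpace ℝ (Fin 2))‖ ^ 2 / (a ^ 2 * c)) =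
        -((π ^ 2 / (a ^ 2 * c)) * ‖(w : EuclideanSpace ℝ (Fin 2))‖ ^ 2) by ring]
    · rw [tsum_congr fun ij : ℤ × ℤ =>
        congrArg Real.exp (SlipThetaPoisson.neg_mul_norm_sq_slip ha.ne' c ij.1 ij.2 ξ hξ),
        LayeredHull.reg_tsum_plane_poisson ht (-y)]
      congr 1
      refine tsum_congr fun w => ?_
      rw [inner_neg_left, mul_neg, Real.cos_neg,
        show -(π ^ 2 * ‖(w : EuclideanSpace ℝ (Fin 2))‖ ^ 2 / (a ^ 2 * c)) =
          -((π ^ 2 / (a ^ 2 * c)) * ‖(w : EuclideanSpace ℝ (Fin 2))‖ ^ 2) by ring]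

end Summit.AtomisticToContinuum.Crystallization.Theorems.HcpLandscapeGapBirth

end
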